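import Summits.BirchSwinnertonDyer.BirchSwinnertonDyer.Theorems.PrintCFramBottomClassIndexLawFiveLeFlipRungTwistVehicle
import Mathlib.NumberTheory.LegendreSymbol.AddCharacter
import HarnessLib

set_option autoImplicit false

/-!
# Crux `PrintCFram.BottomClassIndexLawFiveLe` (stmt-BirchSwinnertonDyer-20372), line `eisenstein-resource-bdp-line` (registry v28 → v29):
# «T8 — THE LOWER-UNIPOTENT RUNG», INPUT SIDE: the lower unipotent matrices `γ_t = [1 0; q²C 1]` (`C ≡ t (mod q²)`, `M ∣ C`), the SINGLE-CLASS
# twist `V_β = q⁻² Σ_j ψ(−jβ) F₀(· + j/q²)` as a `Γ₁(L q⁴)`-form with coefficients `𝟙[n ≡ β (q²)]·c(n)`, and «class `β` ≡ 0 (mod p) at `∞`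
# ⟹ every coefficient at every cusp in `p·ℤ̄[1/N]`» (NF-Q)
# (cell `bsd-print-cfram`, width seat `bsd-line-cfram-p1-w3` g19; THEOREMS ONLY, `--supports` 20372; BSD is not proved by any of this)

HONEST FRAMING. Nothing here is a statement about elliptic curves or BSD; no registered stub is closed. LEAD g14 09:04:50Z adopted the kernel road
T8 (crux notes `Lines/eisenstein-resource-bdp-line-w3g19-notes.md` §2) as the registry target for the last analytic residue. This file is the INPUT
side of its modular assembly (the twin of `…FlipRungModularInput` for a SINGLE class `β mod q²` instead of a Legendre class, and of the cusp data
`γ_t`): §1 the CRT integer `C` with `C ≡ t (mod q²)`, `M ∣ C`, and the lower unipotent `γ = [1 0; q²C 1] ∈ SL₂(ℤ)` (entries exposed); §2 the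
single-class twist `V_β` via `FlipRung.exists_modularForm_twist_coe_eq` with weights `h(j) = ψ_{q²}(−jβ)` — its q-expansion is the class cut
`𝟙[n ≡ β]·c(n)` by orthogonality (`AddChar.sum_mulShift`); §3 the memberships: at `∞` from the class hypothesis alone, and at every cusp by NF-Q
(`FlipRung.exists_isIntegral_qExpansion_slash_coeff`). No new definitions, no named facts, no `sorry`. beyond-print theorem: NO. BSD is not proved
by any of this.

References: M. Raum, Forum Math. 35 (2023) 615–646, Prop. 2.3 [Raum2023RamanujanTypeII]; [Shimura1971] Prop. 3.64; [Katz1973] §1.6 Cor. 1.6.2.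
-/

-- summit-side namespace `Summit.BirchSwinnertonDyer.BirchSwinnertonDyer.…` (single-conjunct summit, D-0017 layout)
set_option linter.dupNamespace false

noncomputable section

namespace Summit.BirchSwinnertonDyer.BirchSwinnertonDyer.Theorems.PrintCFram.FlipRung

open UpperHalfPlane Filter Function Complex CongruenceSubgroup PowerSeries
open scoped MatrixGroups ModularForm Topology Manifold Real

/-! ## §1 The lower unipotent matrices `γ_t` -/

/-- **CRT for the lower unipotent**: for `M` coprime to `q` and any `t ∈ ℤ/q²` there is an integer `C` with `C ≡ t (mod q²)` and `M ∣ C`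
(`C := M·(M⁻¹t mod q²)`). [folklore] -/
theorem exists_int_cast_eq_and_dvd {M q : ℕ} [NeZero (q ^ 2)] (hMq : M.Coprime (q ^ 2)) (t : ZMod (q ^ 2)) :
    ∃ C : ℤ, ((C : ZMod (q ^ 2)) = t) ∧ (M : ℤ) ∣ C := by
  refine ⟨(M : ℤ) * ((t * (M : ZMod (q ^ 2))⁻¹).val : ℤ), ?_, dvd_mul_right _ _⟩
  push_cast
  rw [ZMod.natCast_zmod_val, mul_comm, mul_assoc, mul_comm ((M : ZMod (q ^ 2)))⁻¹, ZMod.coe_mul_inv_eq_one M hMq, mul_one]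

/-- **The lower unipotent `γ = [1 0; c 1] ∈ SL₂(ℤ)`** with its entries exposed (for `c = q²·C` this is the `γ_t` of the lower-unipotent rung;
Raum's `γ ≡ [1 0; 1 1] (mod q²)` up to the normalisation of T3's undilated vehicle). [cite: Raum2023RamanujanTypeII, Prop. 2.3] -/
theorem exists_sl2_lowerUnipotent (c : ℤ) : ∃ γ : SL(2, ℤ), γ 0 0 = 1 ∧ γ 0 1 = 0 ∧ γ 1 0 = c ∧ γ 1 1 = 1 :=
  ⟨⟨!![1, 0; c, 1], by rw [Matrix.det_fin_two_of]; ring⟩, rfl, rfl, rfl, rfl⟩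

/-! ## §2 The single-class twist `V_β` -/

/-- Orthogonality on `ℤ/Q`: `Q⁻¹ Σ_j ψ(−jβ)·ψ(jn) = 𝟙[n = β]`. [folklore] -/
theorem inv_mul_sum_stdAddChar_neg_mul_mul {Q : ℕ} [NeZero Q] (β n : ZMod Q) :
    ((Q : ℂ))⁻¹ * ∑ j : ZMod Q, ZMod.stdAddChar (-(j * β)) * ZMod.stdAddChar (j * n) = if n = β then 1 else 0 := by
  have hQ : (Q : ℂ) ≠ 0 := Nat.cast_ne_zero.mpr (NeZero.ne Q)
  have h := AddChar.sum_mulShift (n - β) (ZMod.isPrimitive_stdAddChar Q)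
  rw [ZMod.card] at h
  have e : ∀ j : ZMod Q, (ZMod.stdAddChar (-(j * β)) : ℂ) * ZMod.stdAddChar (j * n) = ZMod.stdAddChar (j * (n - β)) := by
    intro j; rw [← AddChar.map_add_eq_mul]; congr 1; ring
  simp_rw [e, h, sub_eq_zero]
  split_ifs <;> simp [hQ]

/-- **THE SINGLE-CLASS TWIST IS A MODULAR FORM ON `Γ₁(L q⁴)` with the class cut as q-expansion.** For `F₀ : ModularForm (Gamma1 L) k`, `q ≥ 1`
and `β ∈ ℤ/q²`: `V_β(z) = q⁻² Σ_{j mod q²} ψ_{q²}(−jβ) F₀(z + j/q²)` is (the function of) a `ModularForm (Gamma1 (L (q²)²)) k` with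
`coeff n (qExpansion 1 V_β) = (if (n : ZMod (q²)) = β then 1 else 0) · coeff n (qExpansion 1 F₀)` — the function in T3/T8-2's `hV` shape with
weights `h(j) = ψ_{q²}(−jβ)`. [cite: Shimura1971, Prop. 3.64] -/
theorem exists_modularForm_classTwist {L : ℕ} [NeZero L] {k : ℤ} (F₀ : ModularForm (Gamma1 L) k) (q : ℕ) [NeZero (q ^ 2)]
    (β : ZMod (q ^ 2)) :
    ∃ V : ModularForm (Gamma1 (L * (q ^ 2) ^ 2)) k,
      (∀ z : ℍ, V z = ((q : ℂ) ^ 2)⁻¹ * ∑ j : ZMod (q ^ 2),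
        (ZMod.stdAddChar (-(j * β)) : ℂ) * F₀ (((j.val : ℝ) / (q : ℝ) ^ 2) +ᵥ z)) ∧
      ∀ n : ℕ, (qExpansion 1 ⇑V).coeff n =
        (if ((n : ZMod (q ^ 2)) = β) then 1 else 0) * (qExpansion 1 ⇑F₀).coeff n := by
  obtain ⟨V, hV, hc⟩ := exists_modularForm_twist_coe_eq F₀ q fun j : ZMod (q ^ 2) ↦ (ZMod.stdAddChar (-(j * β)) : ℂ)
  refine ⟨V, hV, fun n ↦ ?_⟩
  rw [hc n]
  congr 1
  have hq2 : ((q : ℂ) ^ 2) = ((q ^ 2 : ℕ) : ℂ) := by push_cast; ring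
  rw [hq2]
  exact inv_mul_sum_stdAddChar_neg_mul_mul β (n : ZMod (q ^ 2))

/-! ## §3 The memberships: class `β` ≡ 0 (mod p) at `∞` ⟹ every coefficient at every cusp in `p·ℤ̄[1/N]` -/

/-- **THE T8 INPUT, AT `∞`.** For `F₀ : ModularForm (Gamma1 L) k` with rational q-expansion `c` and a class `β ∈ ℤ/q²`: if `c(n) ∈ p·ℤ̄[1/N]` for
every `n ≡ β (mod q²)`, then EVERY coefficient of `qExpansion 1 V_β` lies in `p·ℤ̄[1/N]` (the others vanish). [cite: Shimura1971, Prop. 3.64] -/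
theorem exists_classTwist_forall_coeff_mem {L : ℕ} [NeZero L] {k : ℤ} (F₀ : ModularForm (Gamma1 L) k) (q : ℕ) [NeZero (q ^ 2)]
    (β : ZMod (q ^ 2)) {p N : ℕ} {c : ℕ → ℚ} (hc : ∀ n : ℕ, (qExpansion 1 ⇑F₀).coeff n = ((c n : ℚ) : ℂ))
    (hcl : ∀ n : ℕ, (n : ZMod (q ^ 2)) = β → ∃ y : ℂ, (∃ j : ℕ, IsIntegral ℤ ((N : ℂ) ^ j * y)) ∧ ((c n : ℚ) : ℂ) = (p : ℂ) * y) :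
    ∃ V : ModularForm (Gamma1 (L * (q ^ 2) ^ 2)) k,
      (∀ z : ℍ, V z = ((q : ℂ) ^ 2)⁻¹ * ∑ j : ZMod (q ^ 2),
        (ZMod.stdAddChar (-(j * β)) : ℂ) * F₀ (((j.val : ℝ) / (q : ℝ) ^ 2) +ᵥ z)) ∧
      (∀ n : ℕ, (qExpansion 1 ⇑V).coeff n = (if ((n : ZMod (q ^ 2)) = β) then 1 else 0) * ((c n : ℚ) : ℂ)) ∧
      ∀ n : ℕ, ∃ y : ℂ, (∃ j : ℕ, IsIntegral ℤ ((N : ℂ) ^ j * y)) ∧ (qExpansion 1 ⇑V).coeff n = (p : ℂ) * y := by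
  obtain ⟨V, hV, hcoefV⟩ := exists_modularForm_classTwist F₀ q β
  have hcoefV' : ∀ n : ℕ, (qExpansion 1 ⇑V).coeff n = (if ((n : ZMod (q ^ 2)) = β) then 1 else 0) * ((c n : ℚ) : ℂ) := fun n ↦ by
    rw [hcoefV n, hc n]
  have hite : ∀ n : ℕ, (qExpansion 1 ⇑V).coeff n = if ((n : ZMod (q ^ 2)) = β) then ((c n : ℚ) : ℂ) else 0 := fun n ↦ by
    rw [hcoefV' n]; split_ifs <;> simp
  exact ⟨V, hV, hcoefV', forall_coeff_ite_mem (A := qExpansion 1 ⇑V) hite fun n hn ↦ hcl n hn⟩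

/-- **THE T8 INPUT, AT EVERY CUSP (NF-Q).** Same data plus NF-Q, `L q⁴ ∣ N`, `3 ≤ N`: for every `γ ∈ SL₂(ℤ)` (in T8: the lower unipotents `γ_t`),
EVERY coefficient of `qExpansion N (V_β ∣_k γ)` lies in `p·ℤ̄[1/N]`. CONDITIONAL on NF-Q (hypothesis). [cite: Katz1973, §1.6 Cor. 1.6.2] -/
theorem exists_classTwist_forall_coeff_slash_mem
    (hKatz : Literature.NumberTheory.ModularForms.Katz1973_qExpansionPrinciple_allCusps)
    {L : ℕ} [NeZero L] {k : ℤ} (F₀ : ModularForm (Gamma1 L) k) (q : ℕ) [NeZero (q ^ 2)] (β : ZMod (q ^ 2))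
    {p N : ℕ} (hN : L * (q ^ 2) ^ 2 ∣ N) (hN3 : 3 ≤ N) {c : ℕ → ℚ} (hc : ∀ n : ℕ, (qExpansion 1 ⇑F₀).coeff n = ((c n : ℚ) : ℂ))
    (hcl : ∀ n : ℕ, (n : ZMod (q ^ 2)) = β → ∃ y : ℂ, (∃ j : ℕ, IsIntegral ℤ ((N : ℂ) ^ j * y)) ∧ ((c n : ℚ) : ℂ) = (p : ℂ) * y) :
    ∃ V : ModularForm (Gamma1 (L * (q ^ 2) ^ 2)) k,
      (∀ z : ℍ, V z = ((q : ℂ) ^ 2)⁻¹ * ∑ j : ZMod (q ^ 2),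
        (ZMod.stdAddChar (-(j * β)) : ℂ) * F₀ (((j.val : ℝ) / (q : ℝ) ^ 2) +ᵥ z)) ∧
      (∀ n : ℕ, (qExpansion 1 ⇑V).coeff n = (if ((n : ZMod (q ^ 2)) = β) then 1 else 0) * ((c n : ℚ) : ℂ)) ∧
      (∀ n : ℕ, ∃ y : ℂ, (∃ j : ℕ, IsIntegral ℤ ((N : ℂ) ^ j * y)) ∧ (qExpansion 1 ⇑V).coeff n = (p : ℂ) * y) ∧
      ∀ (γ : SL(2, ℤ)) (K : ℕ), ∃ y : ℂ, (∃ j : ℕ, IsIntegral ℤ ((N : ℂ) ^ j * y)) ∧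
        (qExpansion N (⇑V ∣[k] γ)).coeff K = (p : ℂ) * y := by
  obtain ⟨V, hV, hcoefV, hmem⟩ := exists_classTwist_forall_coeff_mem F₀ q β (p := p) (N := N) hc hcl
  exact ⟨V, hV, hcoefV, hmem, fun γ K ↦ exists_isIntegral_qExpansion_slash_coeff hKatz hN hN3 V p hmem γ K⟩

end Summit.BirchSwinnertonDyer.BirchSwinnertonDyer.Theorems.PrintCFram.FlipRung

end
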